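import Mathlib.Analysis.SpecialFunctions.SmoothTransition
import Mathlib.MeasureTheory.Integral.IntervalIntegral.FundThmCalculus
import Mathlib.MeasureTheory.Integral.IntervalIntegral.IntegrationByParts
import Mathlib.Analysis.Calculus.Deriv.MeanValue
import Mathlib.Analysis.Calculus.ContDiff.Basic
import Mathlib.Analysis.Calculus.FDeriv.Add
import HarnessLib

/-!
# A smooth positive part and the smooth maximum of two functions

Topic `Literature/Topology/FourManifolds`; foundational brick of the exp-height line of the fact
seat `provefact-Literature.Topology.FourManifolds.SphereEmbedding.schoenflies_exists_ball`
(Alexander's theorem, Schultens (2014), Thm. 3.2.5), companion of `RegularFamilyIsotopy.lean`.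
**Everything in this file is proved; no definitions, no named facts.**

Cutting a compact regular domain `{F ≤ 0}` along a level disc, rounding the corner, and the
regular families of domains realising Schultens' Lemma 3.2.3 are all written with the *smooth
maximum* `F ⊔_δ ℓ = F + δ P((ℓ - F)/δ)` of two defining functions, where `P` is a smooth
positive part.  So that no definition is needed, the results are stated for an *arbitrary*
admissible profile `P` (smooth, `P = 0` on `(-∞, -1]`, `P(s) = s` on `[1, ∞)`, `0 ≤ P' ≤ 1`,
`max 0 s ≤ P s ≤ max 0 s + 1`), and the existence of one such profile is proved:

* `SmoothMax.exists_smoothPosPart` — `P(s) = ∫_{-1}^{s} λ((t + 1)/2) dt` with Mathlib's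
  `λ = Real.smoothTransition` is admissible (`∫_{-1}^{1} λ((t+1)/2) dt = 1` by the symmetry
  `λ(x) + λ(1 - x) = 1`, `integral_smoothTransition_zero_one`);
* `smax_eq_left`, `smax_eq_right` — off the band `|u - v| < δ` the smooth maximum is the maximum;
  `max_le_smax`, `smax_le_max_add` — `max u v ≤ u ⊔_δ v ≤ max u v + δ`;
  `le_zero_of_smax_nonpos`, `smax_nonpos_of_le` — the sublevel set `{F ⊔_δ ℓ ≤ 0}` sits between
  `{F ≤ -δ} ∩ {ℓ ≤ -δ}` and `{F ≤ 0} ∩ {ℓ ≤ 0}`;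
* `hasFDerivAt_smax` — `D(F ⊔_δ ℓ) = (1 - θ) DF + θ Dℓ`, `θ = P'((ℓ - F)/δ) ∈ [0, 1]`;
  `contDiff_smax`; `fderiv_smax_ne_zero` — if no convex combination of `DF(x)`, `Dℓ(x)`
  vanishes then `x` is a regular point of `F ⊔_δ ℓ` (the regularity criterion for rounded
  corners: `∇F` and `∇ℓ` never oppositely directed on the corner circle).

## References

* J. Schultens, *Introduction to 3-Manifolds*, GSM 151 (2014), Lemma 3.2.3, Thm. 3.2.5.
  [Schultens2014]
* M. W. Hirsch, *Differential Topology*, GTM 33 (1976), Ch. 2 §2 (smoothing by bump functions).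
  [HirschDT1976]
-/

open scoped ContDiff Topology
open Set Filter MeasureTheory intervalIntegral

noncomputable section

namespace Literature.Topology.FourManifolds

namespace SmoothMax

/-! ### §1 Symmetry and the integral of `smoothTransition` -/

/-- `∫₀¹ λ = 1/2` (by the symmetry `λ(1 - x) = 1 - λ(x)`). [folklore] -/
theorem integral_smoothTransition_zero_one :
    ∫ x in (0 : ℝ)..1, Real.smoothTransition x = 1 / 2 := by
  have hc : Continuous Real.smoothTransition := Real.smoothTransition.continuous
  have h1 : ∫ x in (0 : ℝ)..1, Real.smoothTransition (1 - x) =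
      ∫ x in (0 : ℝ)..1, Real.smoothTransition x := by
    rw [intervalIntegral.integral_comp_sub_left (fun x => Real.smoothTransition x) 1]
    norm_num
  have h2 : ∫ x in (0 : ℝ)..1, Real.smoothTransition (1 - x) =
      ∫ x in (0 : ℝ)..1, (1 - Real.smoothTransition x) := by
    refine intervalIntegral.integral_congr fun x _ => ?_
    -- the symmetry `λ(x) + λ(1 - x) = 1` (also `smoothTransition_add_smoothTransition_one_sub`
    -- in `RailNeck.lean`)
    have : Real.smoothTransition x + Real.smoothTransition (1 - x) = 1 := by
      have hd := Real.smoothTransition.pos_denom x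
      unfold Real.smoothTransition
      rw [sub_sub_cancel, add_comm (expNegInvGlue (1 - x)) (expNegInvGlue x), ← add_div,
        div_self hd.ne']
    show Real.smoothTransition (1 - x) = 1 - Real.smoothTransition x
    linarith
  have h3 : ∫ x in (0 : ℝ)..1, (1 - Real.smoothTransition x) =
      1 - ∫ x in (0 : ℝ)..1, Real.smoothTransition x := by
    rw [intervalIntegral.integral_sub intervalIntegrable_const (hc.intervalIntegrable 0 1)]
    simp
  linarith [h1.symm.trans (h2.trans h3)]

/-! ### §2 The smooth positive part `P(s) = ∫_{-1}^{s} λ((t + 1)/2) dt` -/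

/-- **A smooth positive part exists**: a `C^∞` function `P : ℝ → ℝ` with `P = 0` on
`(-∞, -1]`, `P(s) = s` on `[1, ∞)`, `0 ≤ P' ≤ 1`, and `max 0 s ≤ P s ≤ max 0 s + 1` — namely
`P(s) = ∫_{-1}^{s} λ((t+1)/2) dt` with Mathlib's `λ = Real.smoothTransition`
(`∫_{-1}^{1} λ((t+1)/2) dt = 1` by the symmetry of `λ`). [folklore] -/
theorem exists_smoothPosPart :
    ∃ P : ℝ → ℝ, ContDiff ℝ ∞ P ∧ (∀ s, s ≤ -1 → P s = 0) ∧ (∀ s, 1 ≤ s → P s = s) ∧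
      (∀ s, 0 ≤ deriv P s ∧ deriv P s ≤ 1) ∧ (∀ s, max 0 s ≤ P s) ∧ (∀ s, P s ≤ max 0 s + 1) := by
  set σ : ℝ → ℝ := fun t => Real.smoothTransition ((t + 1) / 2) with hσ
  have hσc : Continuous σ := Real.smoothTransition.continuous.comp (by continuity)
  have hσs : ContDiff ℝ ∞ σ :=
    Real.smoothTransition.contDiff.comp ((contDiff_id.add contDiff_const).div_const 2)
  have hσ01 : ∀ t, 0 ≤ σ t ∧ σ t ≤ 1 :=
    fun t => ⟨Real.smoothTransition.nonneg _, Real.smoothTransition.le_one _⟩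
  have hσ0 : ∀ t, t ≤ -1 → σ t = 0 := fun t ht =>
    Real.smoothTransition.zero_of_nonpos (by linarith)
  have hσ1 : ∀ t, 1 ≤ t → σ t = 1 := fun t ht =>
    Real.smoothTransition.one_of_one_le (by linarith)
  set P : ℝ → ℝ := fun s => ∫ t in (-1 : ℝ)..s, σ t with hP
  -- derivative
  have hPd : ∀ s, HasDerivAt P (σ s) s := fun s =>
    intervalIntegral.integral_hasDerivAt_right (hσc.intervalIntegrable _ _)
      (hσc.stronglyMeasurableAtFilter _ _) hσc.continuousAt
  have hderiv : deriv P = σ := funext fun s => (hPd s).deriv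
  have hPdiff : Differentiable ℝ P := fun s => (hPd s).differentiableAt
  -- smoothness
  have hPs : ContDiff ℝ ∞ P := by
    rw [contDiff_infty]
    intro n
    cases n with
    | zero => exact contDiff_zero.2 hPdiff.continuous
    | succ n =>
      push_cast
      rw [contDiff_succ_iff_deriv]
      refine ⟨hPdiff, fun h => absurd h (by simp), ?_⟩
      rw [hderiv]
      exact hσs.of_le (by norm_cast; simp)
  -- values
  have hP0 : ∀ s, s ≤ -1 → P s = 0 := by
    intro s hs
    simp only [hP]
    rw [intervalIntegral.integral_symm, neg_eq_zero]
    rw [intervalIntegral.integral_congr (g := fun _ => (0 : ℝ)) (fun t ht => ?_)]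
    · simp
    · rw [uIcc_of_le hs] at ht
      exact hσ0 t ht.2
  have hI : ∫ t in (-1 : ℝ)..1, σ t = 1 := by
    simp only [hσ]
    rw [intervalIntegral.integral_congr (g := fun t => Real.smoothTransition (t / 2 + 1 / 2))
      (fun t _ => by show Real.smoothTransition ((t + 1) / 2) = _; congr 1; ring)]
    rw [intervalIntegral.integral_comp_div_add (fun x => Real.smoothTransition x) two_ne_zero]
    norm_num [integral_smoothTransition_zero_one]
  have hP1 : ∀ s, 1 ≤ s → P s = s := by
    intro s hs
    simp only [hP]
    rw [← intervalIntegral.integral_add_adjacent_intervals (b := 1)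
      (hσc.intervalIntegrable _ _) (hσc.intervalIntegrable _ _), hI]
    rw [intervalIntegral.integral_congr (g := fun _ => (1 : ℝ)) (fun t ht => ?_)]
    · simp
    · rw [uIcc_of_le hs] at ht
      exact hσ1 t ht.1
  -- bounds
  have hmono : Monotone P := monotone_of_deriv_nonneg hPdiff fun s => by
    rw [hderiv]; exact (hσ01 s).1
  have hanti : Antitone fun s => P s - s := by
    refine antitone_of_deriv_nonpos (hPdiff.sub differentiable_id) fun s => ?_
    have hd : HasDerivAt (fun s => P s - s) (σ s - 1) s := (hPd s).sub (hasDerivAt_id s)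
    rw [hd.deriv]
    linarith [(hσ01 s).2]
  refine ⟨P, hPs, hP0, hP1, fun s => by rw [hderiv]; exact hσ01 s, fun s => ?_, fun s => ?_⟩
  · refine max_le ?_ ?_
    · rcases le_or_gt s (-1) with h | h
      · rw [hP0 s h]
      · simp only [hP]
        exact intervalIntegral.integral_nonneg h.le fun t _ => (hσ01 t).1
    · rcases le_or_gt s 1 with h | h
      · have := hanti h
        simp only [hP1 1 le_rfl, sub_self] at this
        linarith
      · rw [hP1 s h.le]
  · rcases le_or_gt s 1 with h | h
    · have h1 := hmono h
      rw [hP1 1 le_rfl] at h1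
      have : (1 : ℝ) ≤ max 0 s + 1 := by simp
      linarith
    · rw [hP1 s h.le, max_eq_right (by linarith)]
      linarith

/-! ### §3 The smooth maximum `u ⊔_δ v = u + δ P((v - u)/δ)` -/

section Values

variable {P : ℝ → ℝ} {δ : ℝ}

/-- Off the band, on the side `v ≤ u - δ`, the smooth maximum is `u`. [folklore] -/
theorem smax_eq_left (hP0 : ∀ s, s ≤ -1 → P s = 0) (hδ : 0 < δ) {u v : ℝ} (h : v ≤ u - δ) :
    u + δ * P ((v - u) / δ) = u := by
  rw [hP0 _ (by rw [div_le_iff₀ hδ]; linarith), mul_zero, add_zero]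

/-- Off the band, on the side `u ≤ v - δ`, the smooth maximum is `v`. [folklore] -/
theorem smax_eq_right (hP1 : ∀ s, 1 ≤ s → P s = s) (hδ : 0 < δ) {u v : ℝ} (h : u ≤ v - δ) :
    u + δ * P ((v - u) / δ) = v := by
  rw [hP1 _ (by rw [le_div_iff₀ hδ]; linarith), mul_div_cancel₀ _ hδ.ne']
  ring

/-- The smooth maximum dominates the maximum. [folklore] -/
theorem max_le_smax (hPge : ∀ s, max 0 s ≤ P s) (hδ : 0 < δ) (u v : ℝ) :
    max u v ≤ u + δ * P ((v - u) / δ) := by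
  have h := hPge ((v - u) / δ)
  have h0 : 0 ≤ P ((v - u) / δ) := le_trans (le_max_left _ _) h
  have h1 : (v - u) / δ ≤ P ((v - u) / δ) := le_trans (le_max_right _ _) h
  refine max_le (by nlinarith) ?_
  have := mul_le_mul_of_nonneg_left h1 hδ.le
  rw [mul_div_cancel₀ _ hδ.ne'] at this
  linarith

/-- The smooth maximum exceeds the maximum by at most `δ`. [folklore] -/
theorem smax_le_max_add (hPle : ∀ s, P s ≤ max 0 s + 1) (hδ : 0 < δ) (u v : ℝ) :
    u + δ * P ((v - u) / δ) ≤ max u v + δ := by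
  have h := mul_le_mul_of_nonneg_left (hPle ((v - u) / δ)) hδ.le
  rcases le_or_gt 0 ((v - u) / δ) with h0 | h0
  · rw [max_eq_right h0, mul_add, mul_div_cancel₀ _ hδ.ne', mul_one] at h
    have : v ≤ max u v := le_max_right _ _
    linarith
  · rw [max_eq_left h0.le, zero_add, mul_one] at h
    have : u ≤ max u v := le_max_left _ _
    linarith

/-- If the smooth maximum is `≤ 0` then both arguments are `≤ 0`. [folklore] -/
theorem le_zero_of_smax_nonpos (hPge : ∀ s, max 0 s ≤ P s) (hδ : 0 < δ) {u v : ℝ}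
    (h : u + δ * P ((v - u) / δ) ≤ 0) : u ≤ 0 ∧ v ≤ 0 := by
  have := (max_le_smax hPge hδ u v).trans h
  exact ⟨(le_max_left _ _).trans this, (le_max_right _ _).trans this⟩

/-- If both arguments are `≤ -δ` then the smooth maximum is `≤ 0`. [folklore] -/
theorem smax_nonpos_of_le (hPle : ∀ s, P s ≤ max 0 s + 1) (hδ : 0 < δ) {u v : ℝ}
    (hu : u ≤ -δ) (hv : v ≤ -δ) : u + δ * P ((v - u) / δ) ≤ 0 := by
  have := smax_le_max_add hPle hδ u v
  have : max u v ≤ -δ := max_le hu hv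
  linarith

end Values

section Calculus

variable {E : Type*} [NormedAddCommGroup E] [NormedSpace ℝ E] {P : ℝ → ℝ} {δ : ℝ}

/-- **Derivative of the smooth maximum of two functions**: a convex combination of the two
derivatives, `D(F ⊔_δ ℓ) = (1 - θ) DF + θ Dℓ` with `θ = P'((ℓ - F)/δ) ∈ [0, 1]`. [folklore] -/
theorem hasFDerivAt_smax (hPd : Differentiable ℝ P) (hδ : δ ≠ 0) {F ℓ : E → ℝ}
    {F' ℓ' : E →L[ℝ] ℝ} {x : E} (hF : HasFDerivAt F F' x) (hℓ : HasFDerivAt ℓ ℓ' x) :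
    HasFDerivAt (fun y => F y + δ * P ((ℓ y - F y) / δ))
      ((1 - deriv P ((ℓ x - F x) / δ)) • F' + deriv P ((ℓ x - F x) / δ) • ℓ') x := by
  have h1 : HasFDerivAt (fun y => (ℓ y - F y) / δ) (δ⁻¹ • (ℓ' - F')) x :=
    (hℓ.sub hF).mul_const δ⁻¹
  have h2 := (hPd ((ℓ x - F x) / δ)).hasDerivAt.hasFDerivAt.comp x h1
  have h3 := hF.add (h2.const_mul δ)
  refine h3.congr_fderiv ?_
  ext v
  simp [ContinuousLinearMap.toSpanSingleton_apply]
  field_simp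
  ring

/-- The smooth maximum of two `Cⁿ` functions is `Cⁿ`. [folklore] -/
theorem contDiff_smax {n : WithTop ℕ∞} (hP : ContDiff ℝ n P) {F ℓ : E → ℝ} (hF : ContDiff ℝ n F)
    (hℓ : ContDiff ℝ n ℓ) : ContDiff ℝ n fun y => F y + δ * P ((ℓ y - F y) / δ) :=
  hF.add (contDiff_const.mul (hP.comp ((hℓ.sub hF).div_const δ)))

/-- **Regularity criterion for the smooth maximum**: if no convex combination of `DF(x)` and
`Dℓ(x)` vanishes then `D(F ⊔_δ ℓ)(x) ≠ 0` (`P' ∈ [0, 1]`). [folklore] -/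
theorem fderiv_smax_ne_zero (hPd : Differentiable ℝ P)
    (hPd' : ∀ s, 0 ≤ deriv P s ∧ deriv P s ≤ 1) (hδ : δ ≠ 0) {F ℓ : E → ℝ} {x : E}
    (hF : DifferentiableAt ℝ F x) (hℓ : DifferentiableAt ℝ ℓ x)
    (h : ∀ a b : ℝ, 0 ≤ a → 0 ≤ b → a + b = 1 → a • fderiv ℝ F x + b • fderiv ℝ ℓ x ≠ 0) :
    fderiv ℝ (fun y => F y + δ * P ((ℓ y - F y) / δ)) x ≠ 0 := by
  rw [(hasFDerivAt_smax hPd hδ hF.hasFDerivAt hℓ.hasFDerivAt).fderiv]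
  obtain ⟨h0, h1⟩ := hPd' ((ℓ x - F x) / δ)
  exact h _ _ (by linarith) h0 (by ring)

end Calculus

end SmoothMax

end Literature.Topology.FourManifolds

end
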